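/-
Copyright: the b2b-balaban T⁴-continuum CRUX team, row NE7b leaf lineage `t4-ne7b-formalise-leaf-04` (gen 153). Project licence.
-/
import Mathlib.Analysis.Calculus.FDeriv.OfCompLeft
import Mathlib.Analysis.Calculus.FDeriv.Prod
import Mathlib.Analysis.Calculus.FDeriv.Linear
import Mathlib.Analysis.SpecificLimits.Normed
import Mathlib.Analysis.Normed.Operator.NormedSpace
import Mathlib.Analysis.Normed.Operator.Prod

/-!
# THE HARD STEP'S BACKGROUND FIELD IS `C¹` ON THE CHART: `σ′(w) = DΦ(σ w)⁻¹ ∘ inl`, `‖σ′(w)‖ ≤ (N⁻¹ − c)⁻¹`, `D ∘ σ′(w) = 1`,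
# and the graph directions are HESSIAN-ORTHOGONAL to the test directions (`σ′(w)` is the propagator of `V″(σ w)`)
# — the derivative that `…HardStepChartRadius` (HSCR) left NOT HERE, in HSCR's own letters, Mathlib only
# (row NE7b, node U5c; TRANSFER rows (ix)∕(xxiv): King CMP 102 (2.18) «the background field is linear in the kept variable with an
# operator norm for constant», [B11] CMP 102 (47) «A = A′ − H D(A′)», (70)–(71) «‖(I + 𝔎R)⁻¹‖», p. 307 «(δ∕δB)ℋ(B) … has
# regularity and decay properties identical to the propagator H» — idea-1 T-93 (b)'s locus for «σ′ = the propagator»; [folklore])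

Cell `pub-balaban`, sub-cell `t4`, spine estimate NE7b (`T4WeightBudget.RelWeightBound`; the cell's OWN estimate — NOT PRINTED
in [Bałaban 1983–89], NOT PROVED).  Crux-route work under `Spine/NE7b/` by leaf-04 (CRUX team (2), FREEZE (0) crux-prover clause).
NOTHING of Bałaban's is named, asserted, valued or discharged; no `T4Continuum/Support` leaf typed; no `def`; zero `sorry`.  Imports
Mathlib ONLY (the «easy half» of the inverse function theorem `HasFDerivAt.of_comp_of_leftInverse`, `Units.oneSub`, product
calculus) — independent of the `Spine/NE7b` olean frontier: HSCR's CONCLUSIONS enter as displayed hypotheses (letters in, letters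
out), so this file neither imports nor restates HSCR, `…ConstrainedMinimiserRegular` (CMR) or `…QuadraticFibreMinimiser` (QFM).

WHY.  HSCR gives the hard step's background field — the branch `σ` of ι-critical points of `V` over the kept variable `w = Dδ` — on
a chart of explicit radius `ρ = (N⁻¹ − c)·r` with the Lipschitz constant `(N⁻¹ − c)⁻¹`, and says NOT HERE: «`C¹` of `σ` with
`‖Dσ‖ ≤ (N⁻¹ − c)⁻¹`».  CMR (leaf-03) has `σ ∈ Cⁿ` qualitatively (`∀ᶠ`, finite dimension) and the first-order envelope formula;
QFM (leaf-03) builds, for a QUADRATIC fibre problem, the propagator `H` — the right inverse of `D` with form-orthogonal range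
([B11] (47)).  A multi-scale consumer differentiates `σ` itself (the next action is `V ∘ σ`; covariances are read through `σ′`).
THIS FILE supplies `σ′` with its constant, for ANY twice-differentiable `V` on ANY complete `E`, from HSCR's letters alone: (§1) a
`c`-perturbation `A` of `T` (`‖T⁻¹ y‖ ≤ N‖y‖`, `‖A − T‖ ≤ c < N⁻¹`) IS an equivalence with inverse bound `(N⁻¹ − c)⁻¹` — the
operator behind [B11]'s «convergent Neumann series»; (§2) a continuous section of a differentiable chart along a slice is
differentiable, `σ′ = A⁻¹ ∘ inl` (Mathlib's easy half of the inverse function theorem, in the road's letters); (§3) on HSCR's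
chart: at every INTERIOR point of the branch's ball `σ` is differentiable with `‖σ′(w)‖ ≤ (N⁻¹ − c)⁻¹`; (§4) for `Φ = (D, g)`:
`D ∘ σ′(w) = 1`, `g′(σ w) ∘ σ′(w) = 0` — for the critical chart `g = DV(·) ∘ ι`: `V″(σ w)(σ′(w) k)(ι j) = 0`, THE GRAPH DIRECTIONS
ARE `V″(σ w)`-ORTHOGONAL TO THE TEST SPACE, i.e. `σ′(w)` is QFM's propagator of the Hessian AT `σ w` (for quadratic `V` it is `H`,
constant in `w`); (§5) the END in HSCR's `exists_criticalBranch_chart(_ker)` letters.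

WHAT IS PROVED ([folklore]; Dieudonné, *Foundations of Modern Analysis* (10.2.1)–(10.2.3); Deimling, *Nonlinear Functional Analysis*
Thm 15.1–15.2; nothing cited as a fact; nearest tree items: `Literature.Analysis.Calculus.SimplifiedNewton.isInvertible_of_norm_sub_le`
∕ `…RadiiPolynomial.isInvertible_comp_of_norm_id_sub_lt` — invertibility by `Units.oneSub` WITHOUT an inverse bound, other letters;
`…FixedPointSmoothDependence.contDiffAt_of_implicitZero'` — qualitative `Cⁿ` of a zero branch, no constant; none restated).  Standing
letters: `T : E ≃L[ℝ] G` with the POINTWISE bound `‖T⁻¹ y‖ ≤ N‖y‖`, `c < N⁻¹`.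
* §1 `sub_mul_norm_le_norm_apply` (`‖A − T‖ ≤ c ⟹ (N⁻¹ − c)‖x‖ ≤ ‖A x‖`), **`exists_equiv_eq_of_norm_sub_le`** (`E` complete:
  `‖A − T‖ ≤ c ⟹ ∃ A′ : E ≃L G, A′ = A ∧ ‖A′⁻¹ z‖ ≤ (N⁻¹ − c)⁻¹‖z‖` — via `Units.oneSub` on `1 + T⁻¹(A − T)`).
* §2 **`hasFDerivAt_section_slice`** (`σ` continuous at `w`, `Φ (σ w′) = (w′, z₀)` near `w`, `HasFDerivAt Φ A (σ w)` with `A` an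
  equivalence ⟹ `HasFDerivAt σ (A⁻¹ ∘ inl) w`), `norm_symm_comp_inl_le` (`‖A⁻¹ z‖ ≤ L‖z‖ ⟹ ‖A⁻¹ ∘ inl‖ ≤ L`, sup norm).
* §3 **`hasFDerivAt_sliceBranch_of_chart`**: `HasFDerivAt Φ (Φ′ x) x` and `‖Φ′ x − T‖ ≤ c` on `closedBall δ₀ r`; `σ` continuous on
  `closedBall w₀ ρ`, mapping it into `closedBall δ₀ r` with `(Φ (σ w)).1 = w`, `(Φ (σ w)).2 = z₀` (HSCR `exists_sliceBranch`'s
  conclusions, any `ρ`) ⟹ for EVERY `w ∈ ball w₀ ρ`: `Φ′(σ w)` is an equivalence `A`, `‖A⁻¹ z‖ ≤ (N⁻¹ − c)⁻¹‖z‖`,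
  `HasFDerivAt σ (A⁻¹ ∘ inl) w`, `‖A⁻¹ ∘ inl‖ ≤ (N⁻¹ − c)⁻¹`; **`norm_fderiv_sliceBranch_le`** (`‖fderiv ℝ σ w‖ ≤ (N⁻¹ − c)⁻¹`).
* §4 `fst_comp_symm_comp_inl` ∕ `snd_comp_symm_comp_inl` (`A = (D, L)` ⟹ `D ∘ (A⁻¹ ∘ inl) = 1`, `L ∘ (A⁻¹ ∘ inl) = 0`),
  `sub_symm_inl_apply_mem_ker` (`h − (A⁻¹ ∘ inl)(D h) ∈ ker D`), **`hessian_apply_symm_inl_apply_eq_zero`** (`A h = (D h, V″ h ∘ ι)`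
  ⟹ `V″ ((A⁻¹ ∘ inl) k) (ι j) = 0`: the propagator letter).
* §5 THE END: **`hasFDerivAt_criticalBranch_of_chart`** (HSCR `exists_criticalBranch_chart`'s letters — `ι : K →L E`, `‖ι‖ ≤ 1`,
  `HasFDerivAt (fderiv ℝ V) (V″ x) x` and `‖V″ x − V″ δ₀‖ ≤ c` on `closedBall δ₀ r`, `T h = (D h, V″(δ₀) h ∘ ι)` — plus its
  conclusions for `σ` on `closedBall (Dδ₀) ρ` and continuity there ⟹ for every `w ∈ ball (Dδ₀) ρ` an equivalence `A` with
  `A h = (D h, V″(σ w) h ∘ ι)`, `HasFDerivAt σ (A⁻¹ ∘ inl) w`, `‖A⁻¹ ∘ inl‖ ≤ (N⁻¹ − c)⁻¹`, `D ∘ (A⁻¹ ∘ inl) = 1`,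
  `V″(σ w)((A⁻¹ ∘ inl) k)(ι j) = 0`) and **`hasFDerivAt_criticalBranch_of_chart_ker`** (`K := ker D`, `ι` the inclusion).
* §6 toy (`example`): `E = G = ℝ`, `T = 1`, `A = 1`: the bound `‖A⁻¹ z‖ ≤ (1⁻¹ − 0)⁻¹‖z‖`.

NOT HERE (honest): continuity ∕ higher regularity of `w ↦ σ′(w)` with constants (needs a modulus for `V″`; CMR ∕ CMRA give the
qualitative class); the Hessian of `V ∘ σ` (leaf-03's `…ConstrainedValueSecondOrder` ∕ `…ConstrainedValueHessian` own the value side);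
which `Φ, T, N, c, r, ρ` are Bałaban's ((A3) ∕ (A1c), NC-NE7b-α UNRULED).  BY-NAME EFFECT ON THE WALL: NONE.  NE7b NOT PRINTED ∕ NOT PROVED;
spine PROVED 0∕9; rung (B)+1 on a FINITE torus — NOT infinite volume, NOT the mass gap, NOT Clay.  HONEST DEPENDENCY: continuum YM on T⁴ ⇐
BetaPertH ∧ nine spine estimates (0/9 proved); BetaPertH ⇐ (D1) ∧ (D4) ∧ CAP+tail; G-an2-4 gates asym, D1 and NE2∕3∕4.
-/

set_option autoImplicit false

noncomputable section

namespace Summit.QuantumFields.BalabanUV.T4Continuum.NE7b.HardStepBranchDeriv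

open Set Filter Topology Function Metric
open scoped NNReal

variable {E G : Type*} [NormedAddCommGroup E] [NormedSpace ℝ E] [NormedAddCommGroup G] [NormedSpace ℝ G]

/-! ## §1. A `c`-perturbation of the linearisation is an equivalence, inverse bound `(N⁻¹ − c)⁻¹` -/

/-- **LOWER BOUND**: `‖T⁻¹ y‖ ≤ N‖y‖` and `‖A − T‖ ≤ c` give `(N⁻¹ − c)‖x‖ ≤ ‖A x‖`. [folklore] -/
theorem sub_mul_norm_le_norm_apply (T : E ≃L[ℝ] G) {N c : ℝ≥0} (hN : ∀ y : G, ‖T.symm y‖ ≤ N * ‖y‖)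
    (A : E →L[ℝ] G) (hA : ‖A - (T : E →L[ℝ] G)‖ ≤ c) (x : E) :
    ((N : ℝ)⁻¹ - c) * ‖x‖ ≤ ‖A x‖ := by
  have h1 : ‖x‖ ≤ N * ‖T x‖ := by simpa using hN (T x)
  have h2 : (N : ℝ)⁻¹ * ‖x‖ ≤ ‖T x‖ := by
    rcases eq_or_ne N 0 with hN0 | hN0
    · simp [hN0]
    · have hNpos : (0 : ℝ) < N := by exact_mod_cast pos_iff_ne_zero.2 hN0
      rw [inv_mul_le_iff₀ hNpos]
      exact h1
  have h3 : ‖(A - (T : E →L[ℝ] G)) x‖ ≤ c * ‖x‖ :=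
    (ContinuousLinearMap.le_opNorm _ _).trans (mul_le_mul_of_nonneg_right hA (norm_nonneg _))
  have h4 : ‖T x‖ ≤ ‖A x‖ + ‖(A - (T : E →L[ℝ] G)) x‖ := by
    have : (T : E →L[ℝ] G) x = A x - (A - (T : E →L[ℝ] G)) x := by simp
    exact (congrArg norm this).le.trans (norm_sub_le _ _)
  rw [sub_mul]
  linarith

/-- **THE PERTURBED LINEARISATION IS AN EQUIVALENCE** (`E` complete): `‖T⁻¹ y‖ ≤ N‖y‖`, `‖A − T‖ ≤ c`, `c < N⁻¹` ⟹ `A` is (the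
underlying map of) a continuous linear equivalence `A′` with `‖A′⁻¹ z‖ ≤ (N⁻¹ − c)⁻¹‖z‖` — `A = T ∘ (1 + T⁻¹(A − T))` and
`‖T⁻¹(A − T)‖ ≤ N c < 1` (`Units.oneSub`, the Neumann series). [folklore] -/
theorem exists_equiv_eq_of_norm_sub_le [CompleteSpace E] (T : E ≃L[ℝ] G) {N c : ℝ≥0}
    (hN : ∀ y : G, ‖T.symm y‖ ≤ N * ‖y‖) (hc : c < N⁻¹)
    (A : E →L[ℝ] G) (hA : ‖A - (T : E →L[ℝ] G)‖ ≤ c) :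
    ∃ A' : E ≃L[ℝ] G, (A' : E →L[ℝ] G) = A ∧ ∀ z : G, ‖A'.symm z‖ ≤ ((N : ℝ)⁻¹ - c)⁻¹ * ‖z‖ := by
  have hN0 : N ≠ 0 := by rintro rfl; simp at hc
  have hNc : (N : ℝ) * c < 1 := by
    have h : N * c < N * N⁻¹ := mul_lt_mul_of_pos_left hc (pos_iff_ne_zero.2 hN0)
    rw [mul_inv_cancel₀ hN0] at h
    exact_mod_cast h
  -- `S := T⁻¹ ∘ (A − T)` has norm `< 1`
  set S : E →L[ℝ] E := (T.symm : G →L[ℝ] E).comp (A - (T : E →L[ℝ] G)) with hS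
  have hTn : ‖(T.symm : G →L[ℝ] E)‖ ≤ N := ContinuousLinearMap.opNorm_le_bound _ N.coe_nonneg hN
  have hSn : ‖S‖ < 1 :=
    calc ‖S‖ ≤ ‖(T.symm : G →L[ℝ] E)‖ * ‖A - (T : E →L[ℝ] G)‖ := ContinuousLinearMap.opNorm_comp_le _ _
      _ ≤ N * c := mul_le_mul hTn hA (norm_nonneg _) N.coe_nonneg
      _ < 1 := hNc
  have hneg : ‖-S‖ < 1 := by rwa [norm_neg]
  -- `1 + S` is a unit of `E →L E`
  set u : (E →L[ℝ] E)ˣ := Units.oneSub (-S) hneg with hu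
  have huval : (u : E →L[ℝ] E) = 1 + S := by
    rw [hu, Units.val_oneSub, sub_neg_eq_add]
  set A' : E ≃L[ℝ] G := (ContinuousLinearEquiv.unitsEquiv ℝ E u).trans T with hA'
  have hA'x : ∀ x : E, A' x = A x := by
    intro x
    have h1 : A' x = T ((u : E →L[ℝ] E) x) := rfl
    rw [h1, huval]
    simp [hS]
  refine ⟨A', ContinuousLinearMap.ext hA'x, fun z => ?_⟩
  -- the inverse bound from the lower bound
  have hc' : (c : ℝ) < (N : ℝ)⁻¹ := by
    have h := NNReal.coe_lt_coe.2 hc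
    rwa [NNReal.coe_inv] at h
  have hpos : (0 : ℝ) < (N : ℝ)⁻¹ - c := sub_pos.2 hc'
  have hlow := sub_mul_norm_le_norm_apply T hN A hA (A'.symm z)
  rw [← hA'x, A'.apply_symm_apply] at hlow
  rw [← div_eq_inv_mul, le_div_iff₀ hpos, mul_comm]
  exact hlow

/-! ## §2. A continuous section of a differentiable chart along a slice is differentiable -/

section Slice

variable {F H : Type*} [NormedAddCommGroup F] [NormedSpace ℝ F] [NormedAddCommGroup H] [NormedSpace ℝ H]

/-- **THE SECTION ALONG A SLICE IS DIFFERENTIABLE, `σ′ = A⁻¹ ∘ inl`**: `σ` continuous at `w`, `Φ (σ w′) = (w′, z₀)` for `w′` near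
`w`, `HasFDerivAt Φ A (σ w)` with `A` an equivalence ⟹ `HasFDerivAt σ (A⁻¹ ∘ inl) w` (Mathlib's easy half of the inverse
function theorem `HasFDerivAt.of_comp_of_leftInverse` with `h w′ = (w′, z₀)`, `h′ = inl`). [folklore] -/
theorem hasFDerivAt_section_slice {Φ : E → F × H} {σ : F → E} {z₀ : H} {w : F} (A : E ≃L[ℝ] F × H)
    (hσ : ContinuousAt σ w) (hslice : ∀ᶠ w' in 𝓝 w, Φ (σ w') = (w', z₀))
    (hΦ : HasFDerivAt Φ (A : E →L[ℝ] F × H) (σ w)) :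
    HasFDerivAt σ ((A.symm : F × H →L[ℝ] E).comp (ContinuousLinearMap.inl ℝ F H)) w :=
  hΦ.of_comp_of_leftInverse hσ (hasFDerivAt_prodMk_left w z₀) (hslice.mono fun _ h => h) A.symm_apply_apply

/-- The pointwise inverse bound `‖A⁻¹ z‖ ≤ L‖z‖` gives `‖A⁻¹ ∘ inl‖ ≤ L` (sup norm on `F × H`). [folklore] -/
theorem norm_symm_comp_inl_le (A : E ≃L[ℝ] F × H) {L : ℝ} (hL0 : 0 ≤ L) (hL : ∀ z : F × H, ‖A.symm z‖ ≤ L * ‖z‖) :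
    ‖(A.symm : F × H →L[ℝ] E).comp (ContinuousLinearMap.inl ℝ F H)‖ ≤ L := by
  refine ContinuousLinearMap.opNorm_le_bound _ hL0 fun k => ?_
  rw [ContinuousLinearMap.comp_apply, ContinuousLinearMap.inl_apply]
  refine (hL (k, 0)).trans (le_of_eq ?_)
  simp [Prod.norm_def]

/-! ## §3. Assembled on HSCR's chart: the branch is differentiable at every interior point, `‖σ′‖ ≤ (N⁻¹ − c)⁻¹` -/

/-- **THE BRANCH ALONG A SLICE IS `C¹` INSIDE ITS BALL, WITH CONSTANT** (letters of HSCR `exists_sliceBranch` in, derivative out):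
`Φ : E → F × H` with `HasFDerivAt Φ (Φ′ x) x` and `‖Φ′ x − T‖ ≤ c` on `closedBall δ₀ r`, `‖T⁻¹ y‖ ≤ N‖y‖`, `c < N⁻¹`; a map `σ`
continuous on `closedBall w₀ ρ`, mapping it into `closedBall δ₀ r` with `(Φ (σ w)).1 = w`, `(Φ (σ w)).2 = z₀` ⟹ for every INTERIOR
`w ∈ ball w₀ ρ`: `Φ′(σ w)` is an equivalence `A` with `‖A⁻¹ z‖ ≤ (N⁻¹ − c)⁻¹‖z‖`, `HasFDerivAt σ (A⁻¹ ∘ inl) w`, and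
`‖A⁻¹ ∘ inl‖ ≤ (N⁻¹ − c)⁻¹`. [folklore] -/
theorem hasFDerivAt_sliceBranch_of_chart [CompleteSpace E] {Φ : E → F × H} {Φ' : E → E →L[ℝ] F × H}
    (T : E ≃L[ℝ] F × H) {δ₀ : E} {r ρ : ℝ} {N c : ℝ≥0}
    (hN : ∀ y : F × H, ‖T.symm y‖ ≤ N * ‖y‖) (hc : c < N⁻¹)
    (hΦd : ∀ x ∈ closedBall δ₀ r, HasFDerivAt Φ (Φ' x) x)
    (hΦc : ∀ x ∈ closedBall δ₀ r, ‖Φ' x - (T : E →L[ℝ] F × H)‖ ≤ c)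
    {σ : F → E} {w₀ : F} {z₀ : H}
    (hσ : ∀ w ∈ closedBall w₀ ρ, σ w ∈ closedBall δ₀ r ∧ (Φ (σ w)).1 = w ∧ (Φ (σ w)).2 = z₀)
    (hσc : ContinuousOn σ (closedBall w₀ ρ)) {w : F} (hw : w ∈ ball w₀ ρ) :
    ∃ A : E ≃L[ℝ] F × H, (A : E →L[ℝ] F × H) = Φ' (σ w) ∧
      (∀ z : F × H, ‖A.symm z‖ ≤ ((N : ℝ)⁻¹ - c)⁻¹ * ‖z‖) ∧
      HasFDerivAt σ ((A.symm : F × H →L[ℝ] E).comp (ContinuousLinearMap.inl ℝ F H)) w ∧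
      ‖(A.symm : F × H →L[ℝ] E).comp (ContinuousLinearMap.inl ℝ F H)‖ ≤ ((N : ℝ)⁻¹ - c)⁻¹ := by
  have hnhds : closedBall w₀ ρ ∈ 𝓝 w := mem_of_superset (isOpen_ball.mem_nhds hw) ball_subset_closedBall
  have hwc : w ∈ closedBall w₀ ρ := ball_subset_closedBall hw
  obtain ⟨hσw, -, -⟩ := hσ w hwc
  obtain ⟨A, hAeq, hAinv⟩ := exists_equiv_eq_of_norm_sub_le T hN hc (Φ' (σ w)) (hΦc _ hσw)
  have hΦA : HasFDerivAt Φ (A : E →L[ℝ] F × H) (σ w) := by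
    rw [hAeq]
    exact hΦd _ hσw
  have hslice : ∀ᶠ w' in 𝓝 w, Φ (σ w') = (w', z₀) := by
    filter_upwards [hnhds] with w' hw'
    obtain ⟨-, h1, h2⟩ := hσ w' hw'
    exact Prod.ext h1 h2
  have hc' : (c : ℝ) < (N : ℝ)⁻¹ := by
    have h := NNReal.coe_lt_coe.2 hc
    rwa [NNReal.coe_inv] at h
  have hL0 : (0 : ℝ) ≤ ((N : ℝ)⁻¹ - c)⁻¹ := inv_nonneg.2 (sub_pos.2 hc').le
  exact ⟨A, hAeq, hAinv, hasFDerivAt_section_slice A (hσc.continuousAt hnhds) hslice hΦA,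
    norm_symm_comp_inl_le A hL0 hAinv⟩

/-- **`‖Dσ(w)‖ ≤ (N⁻¹ − c)⁻¹`** in `fderiv` currency, under the same letters, at every `w ∈ ball w₀ ρ`. [folklore] -/
theorem norm_fderiv_sliceBranch_le [CompleteSpace E] {Φ : E → F × H} {Φ' : E → E →L[ℝ] F × H}
    (T : E ≃L[ℝ] F × H) {δ₀ : E} {r ρ : ℝ} {N c : ℝ≥0}
    (hN : ∀ y : F × H, ‖T.symm y‖ ≤ N * ‖y‖) (hc : c < N⁻¹)
    (hΦd : ∀ x ∈ closedBall δ₀ r, HasFDerivAt Φ (Φ' x) x)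
    (hΦc : ∀ x ∈ closedBall δ₀ r, ‖Φ' x - (T : E →L[ℝ] F × H)‖ ≤ c)
    {σ : F → E} {w₀ : F} {z₀ : H}
    (hσ : ∀ w ∈ closedBall w₀ ρ, σ w ∈ closedBall δ₀ r ∧ (Φ (σ w)).1 = w ∧ (Φ (σ w)).2 = z₀)
    (hσc : ContinuousOn σ (closedBall w₀ ρ)) {w : F} (hw : w ∈ ball w₀ ρ) :
    DifferentiableAt ℝ σ w ∧ ‖fderiv ℝ σ w‖ ≤ ((N : ℝ)⁻¹ - c)⁻¹ := by
  obtain ⟨A, -, -, hd, hn⟩ := hasFDerivAt_sliceBranch_of_chart T hN hc hΦd hΦc hσ hσc hw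
  exact ⟨hd.differentiableAt, by rwa [hd.fderiv]⟩

end Slice

/-! ## §4. The structure of `σ′(w) = A⁻¹ ∘ inl` for `A = (D, L)`: `D ∘ σ′ = 1`, `L ∘ σ′ = 0` -/

section Structure

variable {F H : Type*} [NormedAddCommGroup F] [NormedSpace ℝ F] [NormedAddCommGroup H] [NormedSpace ℝ H]

/-- `A h = (D h, L h)` ⟹ `D ((A⁻¹ ∘ inl) k) = k`: the derivative of the branch is a RIGHT INVERSE of the kept map. [folklore] -/
theorem fst_apply_symm_inl (A : E ≃L[ℝ] F × H) (D : E →L[ℝ] F) (L : E →L[ℝ] H)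
    (hA : ∀ h : E, A h = (D h, L h)) (k : F) :
    D (((A.symm : F × H →L[ℝ] E).comp (ContinuousLinearMap.inl ℝ F H)) k) = k := by
  have h := hA (A.symm (k, 0))
  rw [A.apply_symm_apply] at h
  have h1 := (Prod.ext_iff.1 h).1
  simpa using h1.symm

/-- `A h = (D h, L h)` ⟹ `L ((A⁻¹ ∘ inl) k) = 0`: the graph directions are killed by the transversal linearisation. [folklore] -/
theorem snd_apply_symm_inl (A : E ≃L[ℝ] F × H) (D : E →L[ℝ] F) (L : E →L[ℝ] H)
    (hA : ∀ h : E, A h = (D h, L h)) (k : F) :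
    L (((A.symm : F × H →L[ℝ] E).comp (ContinuousLinearMap.inl ℝ F H)) k) = 0 := by
  have h := hA (A.symm (k, 0))
  rw [A.apply_symm_apply] at h
  have h2 := (Prod.ext_iff.1 h).2
  simpa using h2.symm

/-- In operator form: `D ∘ (A⁻¹ ∘ inl) = 1`. [folklore] -/
theorem fst_comp_symm_comp_inl (A : E ≃L[ℝ] F × H) (D : E →L[ℝ] F) (L : E →L[ℝ] H)
    (hA : ∀ h : E, A h = (D h, L h)) :
    D.comp ((A.symm : F × H →L[ℝ] E).comp (ContinuousLinearMap.inl ℝ F H)) = ContinuousLinearMap.id ℝ F := by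
  ext k
  exact fst_apply_symm_inl A D L hA k

/-- In operator form: `L ∘ (A⁻¹ ∘ inl) = 0`. [folklore] -/
theorem snd_comp_symm_comp_inl (A : E ≃L[ℝ] F × H) (D : E →L[ℝ] F) (L : E →L[ℝ] H)
    (hA : ∀ h : E, A h = (D h, L h)) :
    L.comp ((A.symm : F × H →L[ℝ] E).comp (ContinuousLinearMap.inl ℝ F H)) = 0 := by
  ext k
  exact snd_apply_symm_inl A D L hA k

/-- Every direction splits as a graph direction plus a fibre direction: `h − (A⁻¹ ∘ inl)(D h) ∈ ker D`. [folklore] -/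
theorem sub_symm_inl_apply_mem_ker (A : E ≃L[ℝ] F × H) (D : E →L[ℝ] F) (L : E →L[ℝ] H)
    (hA : ∀ h : E, A h = (D h, L h)) (h : E) :
    h - ((A.symm : F × H →L[ℝ] E).comp (ContinuousLinearMap.inl ℝ F H)) (D h) ∈ D.ker := by
  rw [LinearMap.mem_ker, ContinuousLinearMap.coe_coe, map_sub, fst_apply_symm_inl A D L hA, sub_self]

/-- **THE PROPAGATOR LETTER**: for the critical chart `A h = (D h, V″ h ∘ ι)` (`V″ = V″(σ w)`, test directions `ι : K →L E`)
the graph directions are `V″`-ORTHOGONAL to the test space: `V″ ((A⁻¹ ∘ inl) k) (ι j) = 0` — `σ′(w)` is the right inverse of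
`D` with Hessian-orthogonal range ([B11] (47)'s `H` for the form `V″(σ w)`; `…QuadraticFibreMinimiser.exists_propagator`'s two
letters). [folklore] -/
theorem hessian_apply_symm_inl_apply_eq_zero {K : Type*} [NormedAddCommGroup K] [NormedSpace ℝ K] (ι : K →L[ℝ] E)
    (A : E ≃L[ℝ] F × (K →L[ℝ] ℝ)) (D : E →L[ℝ] F) (V'' : E →L[ℝ] E →L[ℝ] ℝ)
    (hA : ∀ h : E, A h = (D h, (V'' h).comp ι)) (k : F) (j : K) :
    V'' (((A.symm : F × (K →L[ℝ] ℝ) →L[ℝ] E).comp (ContinuousLinearMap.inl ℝ F (K →L[ℝ] ℝ))) k) (ι j) = 0 := by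
  set R : (E →L[ℝ] ℝ) →L[ℝ] (K →L[ℝ] ℝ) := (ContinuousLinearMap.compL ℝ K E ℝ).flip ι with hR
  have hA' : ∀ h : E, A h = (D h, (R.comp V'') h) := fun h => by
    rw [hA h]
    rfl
  have h0 := snd_apply_symm_inl A D (R.comp V'') hA' k
  have h1 := congrArg (fun Lk : K →L[ℝ] ℝ => Lk j) h0
  simpa [hR] using h1

end Structure

/-! ## §5. THE END in HSCR's critical-branch letters: the background field is `C¹` with `‖σ′‖ ≤ (N⁻¹ − c)⁻¹`, `D σ′ = 1`,
and `σ′` is the propagator of `V″(σ w)` -/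

section Critical

variable {F : Type*} [NormedAddCommGroup F] [NormedSpace ℝ F] [CompleteSpace E]

/-- **THE HARD STEP'S BACKGROUND FIELD IS `C¹` IN THE KEPT VARIABLE, WITH CONSTANT AND STRUCTURE** — the letters of
`…HardStepChartRadius.exists_criticalBranch_chart` (test directions `ι : K →L E`, `‖ι‖ ≤ 1`; `V` twice differentiable on
`closedBall δ₀ r` with `‖V″ x − V″ δ₀‖ ≤ c`; the augmented Hessian `h ↦ (D h, V″(δ₀) h ∘ ι)` an equivalence `T` with
`‖T⁻¹ y‖ ≤ N‖y‖`; `c < N⁻¹`) together with ITS CONCLUSIONS for a map `σ` on `closedBall (Dδ₀) ρ` (values in `closedBall δ₀ r`,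
`D(σ w) = w`, `σ w` ι-critical) and continuity of `σ` there (HSCR: Lipschitz) ⟹ at every `w ∈ ball (Dδ₀) ρ`: the augmented Hessian
AT `σ w`, `h ↦ (D h, V″(σ w) h ∘ ι)`, is an equivalence `A` with `‖A⁻¹ z‖ ≤ (N⁻¹ − c)⁻¹‖z‖`; `HasFDerivAt σ (A⁻¹ ∘ inl) w`;
`‖A⁻¹ ∘ inl‖ ≤ (N⁻¹ − c)⁻¹`; `D ∘ (A⁻¹ ∘ inl) = 1`; and `V″(σ w)((A⁻¹ ∘ inl) k)(ι j) = 0`. [folklore] -/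
theorem hasFDerivAt_criticalBranch_of_chart {K : Type*} [NormedAddCommGroup K] [NormedSpace ℝ K]
    (ι : K →L[ℝ] E) (hι : ‖ι‖ ≤ 1) (D : E →L[ℝ] F) {V : E → ℝ} {V'' : E → E →L[ℝ] E →L[ℝ] ℝ} {δ₀ : E}
    (T : E ≃L[ℝ] F × (K →L[ℝ] ℝ)) (hT : ∀ h, T h = (D h, (V'' δ₀ h).comp ι))
    {r ρ : ℝ} {N c : ℝ≥0} (hN : ∀ y : F × (K →L[ℝ] ℝ), ‖T.symm y‖ ≤ N * ‖y‖) (hc : c < N⁻¹)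
    (hV : ∀ x ∈ closedBall δ₀ r, HasFDerivAt (fderiv ℝ V) (V'' x) x)
    (hVc : ∀ x ∈ closedBall δ₀ r, ‖V'' x - V'' δ₀‖ ≤ c)
    {σ : F → E}
    (hσ : ∀ w ∈ closedBall (D δ₀) ρ, σ w ∈ closedBall δ₀ r ∧ D (σ w) = w ∧ ∀ j : K, fderiv ℝ V (σ w) (ι j) = 0)
    (hσc : ContinuousOn σ (closedBall (D δ₀) ρ)) {w : F} (hw : w ∈ ball (D δ₀) ρ) :
    ∃ A : E ≃L[ℝ] F × (K →L[ℝ] ℝ), (∀ h, A h = (D h, (V'' (σ w) h).comp ι)) ∧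
      (∀ z, ‖A.symm z‖ ≤ ((N : ℝ)⁻¹ - c)⁻¹ * ‖z‖) ∧
      HasFDerivAt σ ((A.symm : F × (K →L[ℝ] ℝ) →L[ℝ] E).comp (ContinuousLinearMap.inl ℝ F (K →L[ℝ] ℝ))) w ∧
      ‖(A.symm : F × (K →L[ℝ] ℝ) →L[ℝ] E).comp (ContinuousLinearMap.inl ℝ F (K →L[ℝ] ℝ))‖ ≤ ((N : ℝ)⁻¹ - c)⁻¹ ∧
      D.comp ((A.symm : F × (K →L[ℝ] ℝ) →L[ℝ] E).comp (ContinuousLinearMap.inl ℝ F (K →L[ℝ] ℝ))) =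
        ContinuousLinearMap.id ℝ F ∧
      ∀ (k : F) (j : K),
        V'' (σ w) (((A.symm : F × (K →L[ℝ] ℝ) →L[ℝ] E).comp (ContinuousLinearMap.inl ℝ F (K →L[ℝ] ℝ))) k) (ι j) = 0 := by
  -- the transversal map `g δ = DV(δ) ∘ ι = R (DV δ)`, `‖R‖ ≤ ‖ι‖ ≤ 1` (as in HSCR)
  set R : (E →L[ℝ] ℝ) →L[ℝ] (K →L[ℝ] ℝ) := (ContinuousLinearMap.compL ℝ K E ℝ).flip ι with hR
  have hRapply : ∀ L : E →L[ℝ] ℝ, R L = L.comp ι := fun L => rfl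
  have hRnorm : ‖R‖ ≤ 1 := by
    refine ContinuousLinearMap.opNorm_le_bound _ zero_le_one fun L => ?_
    rw [hRapply, one_mul]
    exact (L.opNorm_comp_le ι).trans (mul_le_of_le_one_right (norm_nonneg _) hι)
  -- the chart `Φ = (D, g)` and its derivative `Φ′ x = (D, R ∘ V″ x)`
  set Φ : E → F × (K →L[ℝ] ℝ) := fun δ => (D δ, R (fderiv ℝ V δ)) with hΦ
  set Φ' : E → E →L[ℝ] F × (K →L[ℝ] ℝ) := fun x => D.prod (R.comp (V'' x)) with hΦ'
  have hΦd : ∀ x ∈ closedBall δ₀ r, HasFDerivAt Φ (Φ' x) x := fun x hx =>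
    D.hasFDerivAt.prodMk (R.hasFDerivAt.comp x (hV x hx))
  have hTe : (T : E →L[ℝ] F × (K →L[ℝ] ℝ)) = D.prod (R.comp (V'' δ₀)) := by
    ext h <;> simp [hT h, hRapply]
  have hΦc : ∀ x ∈ closedBall δ₀ r, ‖Φ' x - (T : E →L[ℝ] F × (K →L[ℝ] ℝ))‖ ≤ c := by
    intro x hx
    rw [hTe, hΦ']
    have h1 : D.prod (R.comp (V'' x)) - D.prod (R.comp (V'' δ₀)) =
        (0 : E →L[ℝ] F).prod (R.comp (V'' x - V'' δ₀)) := by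
      ext h <;> simp
    rw [h1, ContinuousLinearMap.opNorm_prod, Prod.norm_def, norm_zero, max_eq_right (norm_nonneg _)]
    refine (ContinuousLinearMap.opNorm_comp_le _ _).trans ?_
    calc ‖R‖ * ‖V'' x - V'' δ₀‖ ≤ 1 * c :=
          mul_le_mul hRnorm (hVc x hx) (norm_nonneg (V'' x - V'' δ₀)) zero_le_one
      _ = c := one_mul _
  -- HSCR's conclusions in slice form: `Φ (σ w) = (w, 0)`
  have hσ' : ∀ w' ∈ closedBall (D δ₀) ρ, σ w' ∈ closedBall δ₀ r ∧ (Φ (σ w')).1 = w' ∧ (Φ (σ w')).2 = 0 := by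
    intro w' hw'
    obtain ⟨h1, h2, h3⟩ := hσ w' hw'
    refine ⟨h1, h2, ?_⟩
    show R (fderiv ℝ V (σ w')) = 0
    ext j
    rw [hRapply]
    simpa using h3 j
  obtain ⟨A, hAeq, hAinv, hder, hnorm⟩ := hasFDerivAt_sliceBranch_of_chart T hN hc hΦd hΦc hσ' hσc hw
  have hA : ∀ h, A h = (D h, (V'' (σ w) h).comp ι) := fun h => by
    have h1 := congrArg (fun f : E →L[ℝ] F × (K →L[ℝ] ℝ) => f h) hAeq
    simp only [hΦ'] at h1
    rw [show A h = (A : E →L[ℝ] F × (K →L[ℝ] ℝ)) h from rfl, h1]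
    rfl
  refine ⟨A, hA, hAinv, hder, hnorm, fst_comp_symm_comp_inl A D ((R.comp (V'' (σ w)))) (fun h => ?_), fun k j => ?_⟩
  · rw [hA h]
    rfl
  · exact hessian_apply_symm_inl_apply_eq_zero ι A D (V'' (σ w)) hA k j

/-- **THE SAME WITH `K := ker D`** (`…HardStepChartRadius.exists_criticalBranch_chart_ker`'s letters and conclusions in): at every
`w ∈ ball (Dδ₀) ρ` the background field `σ` of FIBRE-CRITICAL points is differentiable, `σ′(w) = A⁻¹ ∘ inl` for the augmented
Hessian `A h = (D h, V″(σ w) h |_{ker D})` at `σ w`, `‖σ′(w)‖ ≤ (N⁻¹ − c)⁻¹`, `D ∘ σ′(w) = 1`, and `V″(σ w)(σ′(w) k)` KILLS `ker D`.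
[folklore] -/
theorem hasFDerivAt_criticalBranch_of_chart_ker (D : E →L[ℝ] F) {V : E → ℝ} {V'' : E → E →L[ℝ] E →L[ℝ] ℝ} {δ₀ : E}
    (T : E ≃L[ℝ] F × (D.ker →L[ℝ] ℝ)) (hT : ∀ h, T h = (D h, (V'' δ₀ h).comp D.ker.subtypeL))
    {r ρ : ℝ} {N c : ℝ≥0} (hN : ∀ y : F × (D.ker →L[ℝ] ℝ), ‖T.symm y‖ ≤ N * ‖y‖) (hc : c < N⁻¹)
    (hV : ∀ x ∈ closedBall δ₀ r, HasFDerivAt (fderiv ℝ V) (V'' x) x)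
    (hVc : ∀ x ∈ closedBall δ₀ r, ‖V'' x - V'' δ₀‖ ≤ c)
    {σ : F → E}
    (hσ : ∀ w ∈ closedBall (D δ₀) ρ, σ w ∈ closedBall δ₀ r ∧ D (σ w) = w ∧ ∀ k ∈ D.ker, fderiv ℝ V (σ w) k = 0)
    (hσc : ContinuousOn σ (closedBall (D δ₀) ρ)) {w : F} (hw : w ∈ ball (D δ₀) ρ) :
    ∃ A : E ≃L[ℝ] F × (D.ker →L[ℝ] ℝ), (∀ h, A h = (D h, (V'' (σ w) h).comp D.ker.subtypeL)) ∧
      (∀ z, ‖A.symm z‖ ≤ ((N : ℝ)⁻¹ - c)⁻¹ * ‖z‖) ∧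
      HasFDerivAt σ ((A.symm : F × (D.ker →L[ℝ] ℝ) →L[ℝ] E).comp
        (ContinuousLinearMap.inl ℝ F (D.ker →L[ℝ] ℝ))) w ∧
      ‖(A.symm : F × (D.ker →L[ℝ] ℝ) →L[ℝ] E).comp (ContinuousLinearMap.inl ℝ F (D.ker →L[ℝ] ℝ))‖ ≤
        ((N : ℝ)⁻¹ - c)⁻¹ ∧
      D.comp ((A.symm : F × (D.ker →L[ℝ] ℝ) →L[ℝ] E).comp (ContinuousLinearMap.inl ℝ F (D.ker →L[ℝ] ℝ))) =
        ContinuousLinearMap.id ℝ F ∧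
      ∀ (k : F), ∀ j ∈ D.ker,
        V'' (σ w) (((A.symm : F × (D.ker →L[ℝ] ℝ) →L[ℝ] E).comp
          (ContinuousLinearMap.inl ℝ F (D.ker →L[ℝ] ℝ))) k) j = 0 := by
  have hσ' : ∀ w ∈ closedBall (D δ₀) ρ, σ w ∈ closedBall δ₀ r ∧ D (σ w) = w ∧
      ∀ j : D.ker, fderiv ℝ V (σ w) (D.ker.subtypeL j) = 0 := fun w hw =>
    ⟨(hσ w hw).1, (hσ w hw).2.1, fun j => (hσ w hw).2.2 j j.2⟩
  obtain ⟨A, hA, hAinv, hder, hnorm, hid, horth⟩ := hasFDerivAt_criticalBranch_of_chart D.ker.subtypeL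
    (Submodule.norm_subtypeL_le _) D T hT hN hc hV hVc hσ' hσc hw
  exact ⟨A, hA, hAinv, hder, hnorm, hid, fun k j hj => horth k ⟨j, hj⟩⟩

end Critical

/-! ## §6. Toy -/

/-- Toy: `E = G = ℝ`, `T = A = 1`, `N = 1`, `c = 0`: the equivalence of §1 is `1` with `‖A⁻¹ z‖ ≤ (1⁻¹ − 0)⁻¹‖z‖`. [folklore] -/
example : ∃ A' : ℝ ≃L[ℝ] ℝ, (A' : ℝ →L[ℝ] ℝ) = (ContinuousLinearEquiv.refl ℝ ℝ : ℝ →L[ℝ] ℝ) ∧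
    ∀ z : ℝ, ‖A'.symm z‖ ≤ ((((1 : ℝ≥0) : ℝ))⁻¹ - ((0 : ℝ≥0) : ℝ))⁻¹ * ‖z‖ := by
  refine exists_equiv_eq_of_norm_sub_le (ContinuousLinearEquiv.refl ℝ ℝ) (N := 1) (c := 0) (fun y => ?_)
    (by norm_num) _ (by simp)
  simp

end Summit.QuantumFields.BalabanUV.T4Continuum.NE7b.HardStepBranchDeriv

end
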